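import Literature.NumberTheory.Automorphic.BCDTModularity
import Mathlib.NumberTheory.NumberField.Basic
import Mathlib.RingTheory.DedekindDomain.AdicValuation
import HarnessLib

/-!
# Stub-ideation k = 3, GENERATION 15 (home family 3 = PROBE THE EXTREMES) for `stub_liftThree`
# of crux `FreyModularity` (stmt-ABC-11340, route ABC/DefiniteXi, `Lines/Sketch.lean`, sha 21576c53)

Companion of `STUB-IDEAS-stub_liftThree-3.md` (gen 15).  Object of this generation: the
degenerate-witness / extreme-instance pass (family 3a) on the ONE currency typed since gen 14 —
ideator k1's gen-14 weight-one ⇒ weight-two adapter `IN1one 3` with helpers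
`WeightTwoNewformCongrThree N` (H3) and `AttachAlongCongruence := (∀ N, H3 N) → IN1one 3` (H4).

Finding (§1): H3 quantifies the reduction map `ι : 𝓞_f →+* ZMod 3` (inherited from the tree's
wrappers `exists_newform_congr_of_weight_one`, `thm67_weightOne_core`), but a witness of
`IsModularOfWeight 1 ρ` carries `ι : 𝓞_f →+* K` into an ARBITRARY field of characteristic `3`
(residue degree of `ker ι` unconstrained), so H3 is silent for every witness whose prime has
residue degree `> 1` and H4, as typed, is not glue.  Repair = H3′ below (`…Gen`: the same
statement over any field `k₀` of characteristic `3`; the tree's engine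
`DeligneSerre1974.exists_eigenvector_lift` is already stated over an arbitrary DVR, only the
wrapper's `ZMod.ringHom_surjective` step is `ZMod`-specific), with the honest glue H4′
(`AttachAlongCongruenceGen`, conditional on the weight-`≥ 2` newform Galois representations, the
named fact `exists_padicGaloisRep_of_isNewform1`, exactly as H4 silently is).  The alternative
RD1 (`ResidueDegreeOne3`: every weight-one witness of an `𝔽₃`-valued `ρ̄` has residue degree one)
is typed only to exhibit what H4 would otherwise have to contain.

Kernel status: NO `sorry`; statements are `def … : Prop`, the two `theorem`s are proved.
-/

-- `Summit.ABC.ABC` is the mandated nested namespace (single-conjunct summit); duplicate deliberate.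
set_option linter.dupNamespace false

noncomputable section

open scoped MatrixGroups Matrix NumberField ModularForm
open NumberField IsDedekindDomain IsDedekindDomain.HeightOneSpectrum
open Literature.NumberTheory Literature.NumberTheory.Automorphic Literature.NumberTheory.Automorphic.BCDT
open Literature.NumberTheory.GaloisRepresentations Literature.NumberTheory.GaloisRepresentations.ModPGaloisRep
open Literature.NumberTheory.EllipticCurves Literature.NumberTheory.EllipticCurves.ModularForms
open CongruenceSubgroup

namespace Summit.ABC.ABC.Cruxes.FreyModularity.StubIdeas.LiftThree3g15

/-! ## §0 The audited currency (k1-g13/g14, VERBATIM) -/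

/-- The weight-`w` slice of the tree's `ModPGaloisRep.IsModular` (k1-g14, verbatim). [cite: BCDTJAMS2001, Introduction] -/
def IsModularOfWeight {k : Type} [Field k] [TopologicalSpace k] [DiscreteTopology k] (w : ℤ)
    (ρ : ModPGaloisRep ℚ k 2) : Prop :=
  ∃ (N : ℕ) (_ : NeZero N) (f : CuspForm (Gamma1 N) w) (K : Type) (_ : Field K)
    (_ : TopologicalSpace K) (_ : DiscreteTopology K) (j : k →+* K)
    (ι : coeffCharIntegers f →+* K),
    IsNewform1 f ∧
      IsGaloisRepOfNewform1Int f ι {q | q ∣ N * ringChar k}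
        (FramedRep.baseChange j continuous_of_discreteTopology ρ)

/-- DDT Def. 3.12 — `ρ̄` modular of WEIGHT 2 (k1-g13, verbatim: the `w = 2` slice). [cite: DarmonDiamondTaylor1995, Def. 3.12] -/
def IsModularWeightTwo {k : Type} [Field k] [TopologicalSpace k] [DiscreteTopology k]
    (ρ : ModPGaloisRep ℚ k 2) : Prop :=
  IsModularOfWeight 2 ρ

/-- **IN1, weight-one slice** (k1-g14, verbatim). [cite: Wiles1995, Ch. 5] -/
def IN1one (p : ℕ) [Fact p.Prime] : Prop :=
  ∀ ρ : ModPGaloisRep ℚ (ZMod p) 2, FramedRep.IsAbsolutelyIrreducible ρ → IsModularOfWeight 1 ρ →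
    IsModularWeightTwo ρ

/-- **H3 (k1-g14, verbatim)** — note the target `ZMod 3` of `ι`. [cite: DeligneSerreASENS1974, 6.9–6.11] -/
def WeightTwoNewformCongrThree (N : ℕ) [NeZero N] : Prop :=
  ∀ (f : CuspForm (Gamma1 N) 1), IsNewform1 f → ∀ ι : coeffCharIntegers f →+* ZMod 3,
    ∃ (K : IntermediateField ℚ ℂ) (_ : NumberField K) (i : coeffCharField f →+* K)
      (v : HeightOneSpectrum (𝓞 K)) (M₀ : ℕ) (_ : NeZero M₀) (_ : M₀ ∣ N * 3)
      (g₀ : CuspForm (Gamma1 M₀) 2) (a : ℕ → K) (c : ZMod M₀ → K),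
      coeffCharField g₀ ≤ K ∧ (∀ y, ((i y : K) : ℂ) = y) ∧
      IsNewform1 g₀ ∧ (∀ n, ((a n : K) : ℂ) = cuspCoeff g₀ n) ∧
      (∀ d, ((c d : K) : ℂ) = nebentypus g₀ d) ∧
      (∀ y : coeffCharIntegers f, ι y = 0 → v.valuation K (i y) < 1) ∧
      (∀ n : ℕ, v.valuation K (a n) ≤ 1) ∧
      (∀ p : ℕ, p.Prime → ¬ p ∣ N * 3 →
        v.valuation K (a p - i ⟨cuspCoeff f p, cuspCoeff_mem_coeffCharField f p⟩) < 1) ∧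
      (∀ p : ℕ, p.Prime → ¬ p ∣ N * 3 →
        v.valuation K (c p * p -
          i ⟨(nebentypus f (p : ZMod N) : ℂ), nebentypus_mem_coeffCharField f p⟩) < 1)

/-! ## §1 Family 3a — the residue-degree extreme: H3′ over an arbitrary residue field -/

/-- **H3′ (helper TARGET, size M; replaces H3).**  Deligne–Serre 6.8–6.11 + Atkin–Lehner–Li with
the multiplier `E_{1,χ₃}`, for a weight-one newform `f ∈ S₁(Γ₁(N))` and a reduction map
`ι : 𝓞_f → k₀` into ANY field of characteristic `3` (`λ = ker ι` a prime of `𝓞_f` above `3` of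
arbitrary residue degree — the case Deligne–Serre actually treat, "`λ` une place de `K_f`"): a
newform `g₀` of WEIGHT 2 and level `M₀ ∣ 3N`, `v ∣ λ`, `a_p(g₀) ≡ a_p(f)`, `ε_{g₀}(p) p ≡ ε_f(p)`
(mod `v`) for `p ∤ 3N`.  Proof plan = k1-g14's plan for H3 verbatim, except that maximality of
`ker ι` comes from `Ring.DimensionLEOne` of `𝓞_f = integralClosure ℤ K_f` (a nonzero prime of a
Dedekind domain is maximal) instead of `ZMod.ringHom_surjective`; the lifting engine
`DeligneSerre1974.exists_eigenvector_lift` is already stated over an arbitrary DVR.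
[cite: DeligneSerreASENS1974, 6.9–6.11] [cite: DarmonDiamondTaylor1995, Rem. 3.6] -/
def WeightTwoNewformCongrThreeGen (N : ℕ) [NeZero N] : Prop :=
  ∀ (f : CuspForm (Gamma1 N) 1), IsNewform1 f →
    ∀ (k₀ : Type) [Field k₀] [CharP k₀ 3] (ι : coeffCharIntegers f →+* k₀),
    ∃ (K : IntermediateField ℚ ℂ) (_ : NumberField K) (i : coeffCharField f →+* K)
      (v : HeightOneSpectrum (𝓞 K)) (M₀ : ℕ) (_ : NeZero M₀) (_ : M₀ ∣ N * 3)
      (g₀ : CuspForm (Gamma1 M₀) 2) (a : ℕ → K) (c : ZMod M₀ → K),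
      coeffCharField g₀ ≤ K ∧ (∀ y, ((i y : K) : ℂ) = y) ∧
      IsNewform1 g₀ ∧ (∀ n, ((a n : K) : ℂ) = cuspCoeff g₀ n) ∧
      (∀ d, ((c d : K) : ℂ) = nebentypus g₀ d) ∧
      (∀ y : coeffCharIntegers f, ι y = 0 → v.valuation K (i y) < 1) ∧
      (∀ n : ℕ, v.valuation K (a n) ≤ 1) ∧
      (∀ p : ℕ, p.Prime → ¬ p ∣ N * 3 →
        v.valuation K (a p - i ⟨cuspCoeff f p, cuspCoeff_mem_coeffCharField f p⟩) < 1) ∧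
      (∀ p : ℕ, p.Prime → ¬ p ∣ N * 3 →
        v.valuation K (c p * p -
          i ⟨(nebentypus f (p : ZMod N) : ℂ), nebentypus_mem_coeffCharField f p⟩) < 1)

/-- H3′ specialises to H3 (`k₀ = ZMod 3`) — PROVED; the converse is the content of RD1 below and is
NOT formal. [folklore] -/
theorem weightTwoNewformCongrThree_of_gen (N : ℕ) [NeZero N]
    (h : WeightTwoNewformCongrThreeGen N) : WeightTwoNewformCongrThree N :=
  fun f hf ι ↦ h f hf (ZMod 3) ι

/-- **H4′ (helper TARGET, size M given the named fact): attachment along the congruence, honest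
form.**  From H3′ at every level to `IN1one 3`, GRANTED the `λ`-adic representations of newforms of
weight `≥ 2` (`exists_padicGaloisRep_of_isNewform1`, the same named fact `stub_threeImpTwo` waits
on): for a witness `(f, K_w, j, ι)` of `IsModularOfWeight 1 ρ̄` take `k₀ = K_w` in H3′; the clause
`ι y = 0 → v (i y) < 1` and maximality of `ker ι` identify `𝓞_f / ker ι` inside both `K_w` and
`𝓞_K / v`; embed `𝓞_K / v` into an algebraic closure of `K_w` over that common subfield; there the
Frobenius traces of `ρ̄ ⊗ K̄` and of the reduction of `ρ_{g₀,v}` agree at all `p ∤ 3 N M₀`, so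
Chebotarev + Brauer–Nesbitt (tree templates `thm67_weightOne_core`, `ResidualRepOfTraceCongruence`)
give `ρ̄ ⊗ K̄ ≅ ρ̄_{g₀,v}`, which is unramified with the Hecke characteristic polynomial of `g₀` at
every `p ∤ 3 M₀` — i.e. `IsModularWeightTwo ρ̄`. [cite: DeligneSerreASENS1974, 6.12–6.13]
[cite: DarmonDiamondTaylor1995, Thm. 3.1] -/
def AttachAlongCongruenceGen : Prop :=
  (∀ {M : ℕ} [NeZero M] {k : ℤ} (g : CuspForm (Gamma1 M) k),
      exists_padicGaloisRep_of_isNewform1 (f := g)) →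
    (∀ (N : ℕ) [NeZero N], WeightTwoNewformCongrThreeGen N) →
    haveI : Fact (Nat.Prime 3) := ⟨Nat.prime_three⟩; IN1one 3

/-- **RD1 (typed only to measure H4-as-filed; NOT recommended): residue degree one.**  For an
absolutely irreducible `ρ̄ : Γ_ℚ → GL₂(𝔽₃)` every weight-one witness `(f, K, j, ι)` has
`ι(𝓞_f) ⊆ j(𝔽₃)`.  TRUE (lifts of `ρ̄` with finite image are the `3`-power twists of the Schur lift
`GL₂(𝔽₃) ↪ GL₂(ℤ[√-2])`, whose character values lie in `ℤ[√-2]`, and every `a_p(f)`, `p ∣ N`, is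
`0` or a Frobenius eigenvalue on a line of inertia invariants, `∈ ±μ_{3^∞}`), but its proof needs
weight-one local–global compatibility at the primes `p ∣ N`, which the tree does not have
(`IsGaloisRepOfNewform1Int` speaks only of `p ∉ S`).  This is exactly what k1-g14's
`AttachAlongCongruence := (∀ N, H3 N) → IN1one 3` silently contains. [cite: DeligneSerreASENS1974, Thm. 4.6] -/
def ResidueDegreeOne3 : Prop :=
  ∀ (ρ : ModPGaloisRep ℚ (ZMod 3) 2), FramedRep.IsAbsolutelyIrreducible ρ →
    ∀ (N : ℕ) [NeZero N] (f : CuspForm (Gamma1 N) 1) (K : Type) [Field K] [TopologicalSpace K]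
      [DiscreteTopology K] (j : ZMod 3 →+* K) (ι : coeffCharIntegers f →+* K),
      IsNewform1 f →
      IsGaloisRepOfNewform1Int f ι {q | q ∣ N * 3}
        (FramedRep.baseChange j continuous_of_discreteTopology ρ) →
      ∀ y : coeffCharIntegers f, ι y ∈ j.range

/-- With RD1 the filed H4 shape does reduce to H3: every witness factors through `ZMod 3` (PROVED
bookkeeping: `j` is injective, so `ι` descends). [folklore] -/
theorem exists_factor_of_residueDegreeOne3 (hRD : ResidueDegreeOne3)
    (ρ : ModPGaloisRep ℚ (ZMod 3) 2) (hirr : FramedRep.IsAbsolutelyIrreducible ρ)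
    (N : ℕ) [NeZero N] (f : CuspForm (Gamma1 N) 1) (K : Type) [Field K] [TopologicalSpace K]
    [DiscreteTopology K] (j : ZMod 3 →+* K) (ι : coeffCharIntegers f →+* K) (hf : IsNewform1 f)
    (hatt : IsGaloisRepOfNewform1Int f ι {q | q ∣ N * 3}
      (FramedRep.baseChange j continuous_of_discreteTopology ρ)) :
    ∃ ι₀ : coeffCharIntegers f →+* ZMod 3, j.comp ι₀ = ι := by
  classical
  have hmem := hRD ρ hirr N f K j ι hf hatt
  have hj : Function.Injective j := j.injective
  -- descend `ι` along the injective `j`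
  choose g hg using fun y ↦ RingHom.mem_range.mp (hmem y)
  refine ⟨{ toFun := g, map_one' := ?_, map_mul' := ?_, map_zero' := ?_, map_add' := ?_ }, ?_⟩
  · exact hj (by rw [hg, map_one, map_one])
  · intro x y; exact hj (by rw [hg, map_mul, map_mul, hg, hg])
  · exact hj (by rw [hg, map_zero, map_zero])
  · intro x y; exact hj (by rw [hg, map_add, map_add, hg, hg])
  · ext y; exact hg y

end Summit.ABC.ABC.Cruxes.FreyModularity.StubIdeas.LiftThree3g15
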